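import Literature.NumberTheory.LFunctions.LogIntegralOffsetProofs
import Mathlib.Analysis.SpecialFunctions.Pow.Asymptotics
import Mathlib.Analysis.SpecialFunctions.Log.Basic
import HarnessLib

/-!
# Growth lemma for the Jao–Miller–Venkatesan threshold `x = (log q)^B`, `B > 2`

Topic `Computability/Cryptography`; first proof file towards the discharge of the named fact
`Literature.Computability.Cryptography.Csidh.jmv_smallPrimesGenerate` (`CsidhGenerators.lean`:
under ERH the classes of the prime ideals of prime norm `≤ (log 4p)^B` generate `cl(ℤ[√-p])`,
Jao–Miller–Venkatesan 2009, Cor. 1.3 with Thm. 1.1). Everything here is PROVED (theorems only, no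
definition, no named fact).

In the proof of JMV Thm. 1.1 / Cor. 1.3 (J. Number Theory 129 (2009), §2, proof of Thm. 1.1 and of
Cor. 1.3: "`λ_triv = 2 li(x) + O(n x^{1/2} log(xq))`", "`|λ| = O(n x^{1/2} log(xq))`", "if `B > 2`
and `x ≥ (log q)^B` … for `q` sufficiently large") the only analytic input beyond GRH is that, with
`x = (log q)^B` and `B > 2`, the GRH error term `√x · log(xq) ≍ (log q)^{B/2 + 1}` is eventually
smaller than any constant multiple of the main term `li(x) ∼ x / log x = (log q)^B / (B log log q)`.
We prove exactly this, in the variable `u = log q → ∞`: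

* `isLittleO_rpow_half_add_one` — `u^{B/2+1} = o(u^B / log(u^B))` (`B > 2`);
* `eventually_mul_rpow_lt_offsetLogIntegral` — for every real `C`, eventually
  `C · u^{B/2+1} < Li(u^B)` (`Li = offsetLogIntegral`, the tree's `∫₂ˣ dt/log t`, with
  `Li x ∼ x / log x`, `isEquivalent_offsetLogIntegral_holds`);
* `exists_nat_forall_mul_rpow_log_lt_offsetLogIntegral` — the same along `u = log(a p)`,
  `p → ∞` in `ℕ` (`a > 0` fixed, e.g. `a = 4`: `q = 4p = |disc ℤ[√-p]|`), packaged with the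
  side conditions `1 ≤ log(a p)` and `2 ≤ (log(a p))^B` used downstream.

## References

* [JaoMillerVenkatesan2009] D. Jao, S. D. Miller, R. Venkatesan, *Expander graphs based on GRH with
  an application to elliptic curve cryptography*, J. Number Theory 129 (2009) 1491–1504, §2
  (proofs of Thm. 1.1 and Cor. 1.3), arXiv:0811.0647.
-/

noncomputable section

open Filter Asymptotics Topology

namespace Literature.Computability.Cryptography.Csidh

open Literature.NumberTheory.LFunctions

/-- For `B > 2`: `u^{B/2+1} = o(u^B / log(u^B))` as `u → ∞` (the quotient is
`B log u / u^{B/2-1} → 0`). [folklore] -/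
theorem isLittleO_rpow_half_add_one {B : ℝ} (hB : 2 < B) :
    (fun u : ℝ => u ^ (B / 2 + 1)) =o[atTop] fun u => u ^ B / Real.log (u ^ B) := by
  have hr : 0 < B / 2 - 1 := by linarith
  have hB0 : 0 < B := by linarith
  -- `log u / u^{B/2-1} → 0`
  have hlog : Tendsto (fun u : ℝ => Real.log u / u ^ (B / 2 - 1)) atTop (𝓝 0) :=
    (isLittleO_log_rpow_atTop hr).tendsto_div_nhds_zero
  have hquot : Tendsto (fun u : ℝ => u ^ (B / 2 + 1) / (u ^ B / Real.log (u ^ B))) atTop (𝓝 0) := by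
    have h2 : Tendsto (fun u : ℝ => B * (Real.log u / u ^ (B / 2 - 1))) atTop (𝓝 0) := by
      simpa using hlog.const_mul B
    refine h2.congr' ?_
    filter_upwards [eventually_gt_atTop (1 : ℝ)] with u hu
    have hu0 : 0 < u := by linarith
    rw [Real.log_rpow hu0, div_div_eq_mul_div, mul_div_assoc]
    have e1 : u ^ (B / 2 + 1) / u ^ B = (u ^ (B / 2 - 1))⁻¹ := by
      rw [← Real.rpow_sub hu0, ← Real.rpow_neg hu0.le]
      congr 1
      ring
    rw [show u ^ (B / 2 + 1) * (B * Real.log u / u ^ B) =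
      B * (Real.log u * (u ^ (B / 2 + 1) / u ^ B)) by ring, e1, div_eq_mul_inv]
  refine isLittleO_of_tendsto' ?_ hquot
  filter_upwards [eventually_gt_atTop (1 : ℝ)] with u hu h0
  exfalso
  have hu0 : 0 < u := by linarith
  rw [Real.log_rpow hu0, div_eq_zero_iff] at h0
  rcases h0 with h0 | h0
  · exact (Real.rpow_pos_of_pos hu0 B).ne' h0
  · rcases mul_eq_zero.1 h0 with h1 | h1
    · linarith
    · exact (Real.log_pos hu).ne' h1

/-- **The threshold inequality of JMV Cor. 1.3**: for `B > 2` and any real `C`, eventually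
(in `u = log q`) `C · u^{B/2+1} < Li(u^B)`, since `Li(u^B) ∼ u^B / log(u^B)` and
`u^{B/2+1} = o(u^B / log(u^B))`.
[cite: JaoMillerVenkatesan2009, §2, proof of Cor. 1.3] -/
theorem eventually_mul_rpow_lt_offsetLogIntegral {B : ℝ} (hB : 2 < B) (C : ℝ) :
    ∀ᶠ u : ℝ in atTop, C * u ^ (B / 2 + 1) < offsetLogIntegral (u ^ B) := by
  have hB0 : 0 < B := by linarith
  set h : ℝ → ℝ := fun u => u ^ B / Real.log (u ^ B) with hh
  -- `Li(u^B) ∼ h`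
  have hequiv : (fun u : ℝ => offsetLogIntegral (u ^ B)) ~[atTop] h :=
    (isEquivalent_offsetLogIntegral_holds.comp_tendsto (tendsto_rpow_atTop hB0))
  have hsmall : (fun u : ℝ => |C| * u ^ (B / 2 + 1)) =o[atTop] h :=
    (isLittleO_rpow_half_add_one hB).const_mul_left |C|
  -- `h > 0` eventually
  have hpos : ∀ᶠ u : ℝ in atTop, 0 < h u := by
    filter_upwards [eventually_gt_atTop (1 : ℝ)] with u hu
    have hu0 : 0 < u := by linarith
    simp only [hh]
    rw [Real.log_rpow hu0]
    exact div_pos (Real.rpow_pos_of_pos hu0 B) (mul_pos hB0 (Real.log_pos hu))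
  have h1 := hequiv.isLittleO.def (by norm_num : (0 : ℝ) < 1 / 2)
  have h2 := hsmall.def (by norm_num : (0 : ℝ) < 1 / 4)
  filter_upwards [h1, h2, hpos] with u hu1 hu2 hu3
  simp only [Pi.sub_apply, Real.norm_eq_abs] at hu1 hu2
  rw [abs_of_pos hu3] at hu1 hu2
  have hC : C * u ^ (B / 2 + 1) ≤ |(|C| * u ^ (B / 2 + 1))| := by
    refine (le_abs_self _).trans ?_
    rw [abs_mul, abs_mul, abs_abs]
  have hg : h u / 2 ≤ offsetLogIntegral (u ^ B) := by
    linarith [neg_abs_le (offsetLogIntegral (u ^ B) - h u)]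
  linarith

/-- **Natural-number form.** For `B > 2`, `a > 0` and any real `C` there is `P₀` such that for all
natural `p ≥ P₀`, with `u = log(a p)` and `x = u^B`: `C · u^{B/2+1} < Li(x)`, `1 ≤ u` and `2 ≤ x`
(the "for `q` sufficiently large" of JMV Cor. 1.3, `q = a p`).
[cite: JaoMillerVenkatesan2009, Cor. 1.3] -/
theorem exists_nat_forall_mul_rpow_log_lt_offsetLogIntegral {B : ℝ} (hB : 2 < B) (C : ℝ) {a : ℝ}
    (ha : 0 < a) :
    ∃ P₀ : ℕ, ∀ p : ℕ, P₀ ≤ p →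
      C * Real.log (a * p) ^ (B / 2 + 1) < offsetLogIntegral (Real.log (a * p) ^ B) ∧
        1 ≤ Real.log (a * p) ∧ 2 ≤ Real.log (a * p) ^ B := by
  have hB0 : 0 < B := by linarith
  -- `u = log(a p) → ∞` along `p → ∞` in `ℕ`
  have hu : Tendsto (fun p : ℕ => Real.log (a * p)) atTop atTop :=
    Real.tendsto_log_atTop.comp (Tendsto.const_mul_atTop ha tendsto_natCast_atTop_atTop)
  have hev : ∀ᶠ u : ℝ in atTop,
      C * u ^ (B / 2 + 1) < offsetLogIntegral (u ^ B) ∧ 1 ≤ u ∧ 2 ≤ u ^ B := by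
    filter_upwards [eventually_mul_rpow_lt_offsetLogIntegral hB C, eventually_ge_atTop (1 : ℝ),
      (tendsto_rpow_atTop hB0).eventually (eventually_ge_atTop (2 : ℝ))] with u h1 h2 h3
    exact ⟨h1, h2, h3⟩
  obtain ⟨P₀, hP₀⟩ := eventually_atTop.1 (hu.eventually hev)
  exact ⟨P₀, fun p hp => hP₀ p hp⟩

end Literature.Computability.Cryptography.Csidh

end
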